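import Literature.ComputerArithmetic.Shewchuk1997.Compress
import Mathlib.Tactic.Linarith
import Mathlib.Tactic.Positivity
import Mathlib.Tactic.Ring
import Mathlib.Tactic.NormNum

/-!
# The top pair of every COMPRESS output is absorbed (new work)

New work of the certified-arithmetic venture (ENGINES group: shared numerical engines serving
client cells; rigour lives in the verifiers; every published number belongs to a client cell's
ledger, not to the engines group).

For COMPRESS [Shewchuk1997, §2.7 Theorem 23] under ANY round-to-nearest `fl`, any precision
`p ≥ 2` (gradual underflow), applied to a nonoverlapping expansion of floats: if the output has at
least two components, `h = l ++ ⟨a, b⟩`, then the largest component ABSORBS the next one,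
`fl(b + a) = b` (`compress_top_absorbed`).  Since the fixed points of COMPRESS are exactly the
chains (`CompressStaircaseFixedPoint` / `CompressFixedPointChain`), this localises the
non-idempotence of COMPRESS (`CompressNotIdempotent`) strictly below the top pair; in particular
two-component outputs are chains, hence final.

Proof: re-run the upward traversal of Theorem 23's proof (the tree's `UpInv.emit` /
`UpInv.absorb` steps) carrying the extra invariant "the most recently emitted component `r`
satisfies `fl(Q + r) = Q`, `|r| ≤ ulp(Q)/2`, and the components emitted before it sum to less
than `|r|`" for the carry `Q` (`compressUp_top_absorbed`).  An emitting step establishes it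
literally (`Qn + q = g + Q`, `Qn = fl(g + Q)`, older components nonoverlapping below `q`).  An
exact step `Q ↦ g + Q` keeps it (`fl_add_eq_self_after_absorb`): with `ulp(g) = 2^u`, either
`|Q| < 2^u`, then `|Q| ≤ 2^u − 2^(u−p)` (Literature lemma `abs_le_sub_of_abs_lt_two_zpow`),
`|r| ≤ 2^(u−p−1)` and `|g + Q + r| ≥ 2^u`; or `|Q| = 2^u`, and then the stair
`|Q + r + tail| < ulp(g)` forces `r` to have the sign opposite to `Q`, so `fl(Q + r) = Q`
approaches the power of two `|Q|` from inside, which costs `|r| ≤ ulp(Q)/4 = 2^(u−p−1)` (the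
predecessor `2^u − 2^(u−p)` must not be nearer), and again `|g + Q + r| ≥ 2^u`.  In both cases
`|r| ≤ ulp(g + Q + r)/4`, and Property 2.7 of [BoldoEtAl2023] (`fl_eq_of_abs_sub_lt_half_ulp`)
gives `fl(g + Q + r) = g + Q` — for every `p ≥ 2`, with no rounding tie ever arising.
HONEST FRAMING: a structural fact about the printed algorithm, not a claim of the paper.
-/

namespace Summit.Ventures.CertifiedArithmetic.Expansions

open Literature.ComputerArithmetic.JeannerodRump2018
open Literature.ComputerArithmetic.BoldoJeannerodMelquiondMuller2023 hiding twoSum twoSum_fst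
open Literature.ComputerArithmetic.Shewchuk1997

variable {p : ℕ} {emin : ℤ}

/-- `|t| < 2^u` bounds the ulp: `ulp(t) ≤ 2^max(emin, u−p)`. [cite: BoldoEtAl2023, §2.1] -/
private theorem ulp_le_of_abs_lt_two_zpow' {t : ℚ} {u : ℤ} (ht : |t| < (2 : ℚ) ^ u) :
    ulp p emin t ≤ (2 : ℚ) ^ (max emin (u - p)) := by
  by_cases ht0 : t = 0
  · rw [ht0, ulp_zero]
    exact zpow_le_zpow_right₀ (by norm_num) (le_max_left _ _)
  · rw [ulp_of_ne_zero ht0]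
    apply zpow_le_zpow_right₀ (by norm_num)
    have hpos : 0 < |t| := abs_pos.mpr ht0
    have hlog : Int.log 2 |t| < u := (Int.lt_zpow_iff_log_lt (b := 2) (by norm_num) hpos).mp ht
    exact max_le_max le_rfl (by omega)

/-- Exact-step margin for every precision `p ≥ 2` and every round-to-nearest: after an exact
FAST-TWO-SUM `g ⊕ Q = g + Q` in the upward traversal, the previously emitted head `r`
(`fl(Q + r) = Q`, `|r| ≤ ulp(Q)/2`, tail `T` below `r`, stair `|Q + (r + T)| < ulp g`) is still
absorbed: `fl(g + Q + r) = g + Q`.  [cite: Shewchuk1997, §2.7 Theorem 23 (proof)]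
[cite: BoldoEtAl2023, §2.6 Property 2.7] -/
theorem fl_add_eq_self_after_absorb (hp : 2 ≤ p) {fl : ℚ → ℚ}
    (hfl : IsRoundNearest p emin fl) {g Q r T : ℚ} (hgbig : (2 : ℚ) ^ (emin + p) ≤ |g|)
    (hQ : IsFloat p emin Q) (hQg : |Q| ≤ ulp p emin g) (hQn : IsFloat p emin (g + Q))
    (hr : IsFloat p emin r) (hr0 : r ≠ 0) (hrQ : |r| ≤ ulp p emin Q / 2)
    (hfr : fl (Q + r) = Q) (hst : |Q + (r + T)| < ulp p emin g) (hT : |T| < |r|) :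
    fl (g + Q + r) = g + Q := by
  have hp1 : 1 ≤ p := le_trans (by norm_num) hp
  obtain ⟨u, hu, hU⟩ := exists_ulp_eq_two_zpow (p := p) (emin := emin) g
  have hu1 : emin + 1 ≤ u := by
    have h := two_zpow_le_ulp_of_le_abs (p := p) (emin := emin) (emin + p) hgbig
    have e : emin + (p : ℤ) - p + 1 = emin + 1 := by ring
    rw [hU, e] at h
    exact (zpow_le_zpow_iff_right₀ (by norm_num : (1 : ℚ) < 2)).mp h
  have hgu : (2 : ℚ) ^ (u + p - 1) ≤ |g| := two_zpow_le_abs_of_ulp_eq hU (by omega)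
  have hr_ge : (2 : ℚ) ^ emin ≤ |r| := (OnGrid.of_isFloat hr).two_zpow_le_abs hr0
  have hemin : (0 : ℚ) < (2 : ℚ) ^ emin := zpow_pos (by norm_num) _
  have hg0 : g ≠ 0 := by
    intro h
    rw [h, abs_zero] at hgbig
    linarith [zpow_pos (by norm_num : (0 : ℚ) < 2) (emin + p)]
  have hP : (4 : ℚ) ≤ (2 : ℚ) ^ (p : ℤ) := by
    rw [zpow_natCast]
    calc (4 : ℚ) = 2 ^ 2 := by norm_num
      _ ≤ 2 ^ p := pow_le_pow_right₀ (by norm_num) hp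
  have hUpos : (0 : ℚ) < (2 : ℚ) ^ u := zpow_pos (by norm_num) _
  have hPpos : (0 : ℚ) < (2 : ℚ) ^ (p : ℤ) := zpow_pos (by norm_num) _
  have eUP : (2 : ℚ) ^ (u - p) = 2 ^ u / 2 ^ (p : ℤ) := zpow_sub₀ (by norm_num) _ _
  have e1 : (2 : ℚ) ^ (u + 1 - p) = 2 ^ u / 2 ^ (p : ℤ) * 2 := by
    rw [show u + 1 - (p : ℤ) = u - p + 1 by ring, zpow_add_one₀ (by norm_num), eUP]
  have e2 : (2 : ℚ) ^ (u + p - 1) = 2 ^ u * 2 ^ (p : ℤ) / 2 := by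
    rw [zpow_sub_one₀ (by norm_num), zpow_add₀ (by norm_num)]; ring
  rw [e2] at hgu
  rw [hU] at hQg hst
  have hUP : (2 : ℚ) ^ u * 4 ≤ 2 ^ u * 2 ^ (p : ℤ) := mul_le_mul_of_nonneg_left hP hUpos.le
  have hDpos : (0 : ℚ) < 2 ^ u / 2 ^ (p : ℤ) := div_pos hUpos hPpos
  have hD4 : (2 : ℚ) ^ u / 2 ^ (p : ℤ) ≤ 2 ^ u / 4 :=
    div_le_div_of_nonneg_left hUpos.le (by norm_num) hP
  -- the finishing move: `|g + Q + r| ≥ 2^u` and `|r| ≤ D/2` give absorption (Property 2.7)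
  have finish : (2 : ℚ) ^ u ≤ |g + Q + r| → |r| ≤ 2 ^ u / 2 ^ (p : ℤ) / 2 →
      fl (g + Q + r) = g + Q := by
    intro ht hrs
    apply fl_eq_of_abs_sub_lt_half_ulp hp1 hfl hQn
    rw [show g + Q + r - (g + Q) = r by ring]
    have hW := two_zpow_le_ulp_of_le_abs (p := p) (emin := emin) u ht
    rw [show u - (p : ℤ) + 1 = u - p + 1 by ring, zpow_add_one₀ (by norm_num), eUP] at hW
    linarith
  have habs3 : |g| ≤ |g + Q + r| + |Q| + |r| := by
    calc |g| = |g + Q + r + -Q + -r| := by ring_nf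
      _ ≤ |g + Q + r| + |-Q| + |-r| := abs_add_three _ _ _
      _ = |g + Q + r| + |Q| + |r| := by rw [abs_neg, abs_neg]
  rcases hQg.lt_or_eq with hlt | heq
  · -- CASE A: `|Q| < 2^u = ulp g`.
    have h1 := ulp_le_of_abs_lt_two_zpow' (p := p) (emin := emin) hlt
    have hcase : emin ≤ u - p := by
      by_contra hc
      rw [not_le] at hc
      rw [max_eq_left hc.le] at h1
      linarith
    rw [max_eq_right hcase, eUP] at h1
    have hrs : |r| ≤ 2 ^ u / 2 ^ (p : ℤ) / 2 := by linarith
    have hQle := abs_le_sub_of_abs_lt_two_zpow hp1 hQ hlt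
    rw [eUP] at hQle
    exact finish (by linarith) hrs
  · -- CASE B: `|Q| = 2^u`: the stair forces `r` opposite in sign to `Q`, and then
    -- `fl(Q + r) = Q` (a power of two approached from inside) forces `|r| ≤ ulp(Q)/4`.
    have hulpQ := ulp_le_of_abs_lt_two_zpow' (p := p) (emin := emin) (t := Q) (u := u + 1)
      (by rw [zpow_add_one₀ (by norm_num)]; linarith)
    have hcase : emin ≤ u - p := by
      by_contra hc
      rw [not_le] at hc
      rw [max_eq_left (by omega : u + 1 - (p : ℤ) ≤ emin)] at hulpQ
      linarith
    rw [max_eq_right (by omega : emin ≤ u + 1 - (p : ℤ)), e1] at hulpQ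
    have hr1 : |r| ≤ 2 ^ u / 2 ^ (p : ℤ) := by linarith
    have hcF : IsFloat p emin ((2 : ℚ) ^ u - 2 ^ u / 2 ^ (p : ℤ)) := by
      refine ⟨2 ^ p - 1, u - p, ?_, hcase, ?_⟩
      · have h0 : (1 : ℤ) ≤ 2 ^ p := one_le_pow₀ (by norm_num)
        rw [abs_of_nonneg (by omega)]
        omega
      · push_cast
        rw [eUP, zpow_natCast]
        field_simp
    have hgcase : g ≤ -(2 ^ u * 2 ^ (p : ℤ) / 2) ∨ 2 ^ u * 2 ^ (p : ℤ) / 2 ≤ g :=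
      le_abs'.mp hgu
    obtain ⟨hst1, hst2⟩ := abs_lt.mp hst
    rcases (abs_eq hUpos.le).mp heq with hQe | hQe <;>
      rcases lt_or_gt_of_ne hr0 with hrn | hrp
    · -- `Q = 2^u`, `r < 0`
      have hmin := (hfl (Q + r)).2 _ hcF
      rw [hfr, show Q + r - Q = r by ring,
        show Q + r - ((2 : ℚ) ^ u - 2 ^ u / 2 ^ (p : ℤ)) = r + 2 ^ u / 2 ^ (p : ℤ) by
          rw [hQe]; ring] at hmin
      rw [abs_of_neg hrn] at hmin hr1
      rw [abs_of_nonneg (by linarith)] at hmin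
      refine finish ?_ (by rw [abs_of_neg hrn]; linarith)
      rcases hgcase with hgn | hgp
      · exact le_abs.mpr (Or.inr (by linarith))
      · exact le_abs.mpr (Or.inl (by linarith))
    · -- `Q = 2^u`, `r > 0`: contradicts the stair
      exfalso
      rw [abs_of_pos hrp] at hT
      linarith [neg_abs_le T]
    · -- `Q = -2^u`, `r < 0`: contradicts the stair
      exfalso
      rw [abs_of_neg hrn] at hT
      linarith [le_abs_self T]
    · -- `Q = -2^u`, `r > 0`
      have hmin := (hfl (Q + r)).2 _ hcF.neg
      rw [hfr, show Q + r - Q = r by ring,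
        show Q + r - -((2 : ℚ) ^ u - 2 ^ u / 2 ^ (p : ℤ)) = r - 2 ^ u / 2 ^ (p : ℤ) by
          rw [hQe]; ring] at hmin
      rw [abs_of_pos hrp] at hmin hr1
      rw [abs_of_nonpos (by linarith)] at hmin
      refine finish ?_ (by rw [abs_of_pos hrp]; linarith)
      rcases hgcase with hgn | hgp
      · exact le_abs.mpr (Or.inr (by linarith))
      · exact le_abs.mpr (Or.inl (by linarith))

/-- THE UPWARD TRAVERSAL WITH THE TOP-PAIR INVARIANT (`p ≥ 2`): under the hypotheses of the tree's
`compressUp_spec` (invariant `UpInv`, remaining components floats `≥ 2^(emin+p)` obeying the stair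
and the chain, carry below the ulp of the next component) AND "the most recent emitted component
`r` has `fl(Q + r) = Q`, `|r| ≤ ulp(Q)/2`, and the older ones sum below `|r|`", the output
`rs.reverse ++ compressUp fl Q gs` is `rs'.reverse ++ ⟨Q_f⟩` with `fl(Q_f + r') = Q_f` for the
last emitted `r'`.  [cite: Shewchuk1997, Thm 23 p. 333 (proof, lines 10–16)] -/
theorem compressUp_top_absorbed (hp : 2 ≤ p) {fl : ℚ → ℚ} (hfl : IsRoundNearest p emin fl) :
    ∀ (gs : List ℚ) (Q : ℚ) (rs : List ℚ), UpInv p emin 1 rs Q →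
      (∀ g ∈ gs, IsFloat p emin g) → (∀ g ∈ gs, (2 : ℚ) ^ (emin + p) ≤ |g|) →
      UStair p emin (Q + rs.sum) gs → gs.IsChain (fun a b => |a| ≤ ulp p emin b) →
      (∀ g ∈ gs.head?, |Q| ≤ ulp p emin g) →
      (∀ r ∈ rs.head?, fl (Q + r) = Q ∧ |r| ≤ ulp p emin Q / 2) →
      (∀ r tl, rs = r :: tl → |tl.sum| < |r|) →
      ∃ (rs' : List ℚ) (Qf : ℚ), rs.reverse ++ compressUp fl Q gs = rs'.reverse ++ [Qf] ∧
        ∀ r ∈ rs'.head?, fl (Qf + r) = Qf := by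
  have hp1 : 1 ≤ p := le_trans (by norm_num) hp
  intro gs
  induction gs with
  | nil =>
    intro Q rs _ _ _ _ _ _ htop _
    rw [compressUp_nil]
    exact ⟨rs, Q, rfl, fun r hr => (htop r hr).1⟩
  | cons g rest ih =>
    intro Q rs inv hF hbig hst hch hQg htop htl
    have hg : IsFloat p emin g := hF g (by simp)
    have hgbig : (2 : ℚ) ^ (emin + p) ≤ |g| := hbig g (by simp)
    have hQg' : |Q| ≤ ulp p emin g := hQg g (by simp)
    have hF' : ∀ x ∈ rest, IsFloat p emin x := fun x hx => hF x (List.mem_cons_of_mem _ hx)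
    have hbig' : ∀ x ∈ rest, (2 : ℚ) ^ (emin + p) ≤ |x| :=
      fun x hx => hbig x (List.mem_cons_of_mem _ hx)
    obtain ⟨hstQ, hst'⟩ := uStair_cons.mp hst
    obtain ⟨hgU, hch'⟩ := List.isChain_cons.mp hch
    have hg0 : g ≠ 0 := by
      intro h; rw [h, abs_zero] at hgbig
      exact absurd hgbig (not_le.mpr (zpow_pos (by norm_num) _))
    have hulpg : ulp p emin g ≤ |g| := ulp_le_abs_of_isFloat hg hg0
    have hQleg : |Q| ≤ |g| := hQg'.trans hulpg
    obtain ⟨h1, -, h2, h4⟩ := fastTwoSum_exact hp1 hfl hg inv.hQ hQleg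
    by_cases hq : (fastTwoSum fl g Q).2 = 0
    · -- exact step
      obtain ⟨inv', hQnval, hQn_ge⟩ := inv.absorb hp hfl hg hgbig hQg' hq
      rw [compressUp_cons_of_eq_zero hq]
      generalize hQn : (fastTwoSum fl g Q).1 = Qn at *
      have hS : Qn + rs.sum = Q + rs.sum + g := by rw [hQnval]; ring
      have hQg_next : ∀ y ∈ rest.head?, |Qn| ≤ ulp p emin y := by
        intro y hy
        have hgy : |g| ≤ ulp p emin y := hgU y hy
        have hT : |Qn + rs.sum| < ulp p emin y := by rw [hS]; exact hst'.head_lt hy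
        obtain ⟨u, -, hU⟩ := exists_ulp_eq_two_zpow (p := p) (emin := emin) y
        obtain ⟨k, -, hK⟩ := exists_ulp_eq_two_zpow (p := p) (emin := emin) Q
        have hkQ : OnGrid k Q := by
          obtain ⟨K, hK'⟩ := exists_eq_int_mul_ulp_of_isFloat (p := p) (emin := emin) inv.hQ
          exact ⟨K, by rw [← hK]; exact hK'⟩
        have hkg : OnGrid k g :=
          onGrid_of_two_zpow_le_ulp hg (by rw [← hK]; exact ulp_mono hQleg)
        have hkQn : OnGrid k Qn := by rw [hQnval]; exact hkg.add hkQ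
        have hku : k ≤ u := by
          have : (2 : ℚ) ^ k ≤ (2 : ℚ) ^ u := by
            rw [← hK, ← hU]; exact (ulp_mono hQleg).trans (hulpg.trans hgy)
          exact (zpow_le_zpow_iff_right₀ (by norm_num : (1 : ℚ) < 2)).mp this
        have hr : |rs.sum| < (2 : ℚ) ^ k := by rw [← hK]; exact inv.sum_lt
        rw [hU]
        exact abs_le_two_zpow_of_onGrid hku hkQn hr (by rw [← hU]; exact hT)
      have htop' : ∀ r ∈ rs.head?, fl (Qn + r) = Qn ∧ |r| ≤ ulp p emin Qn / 2 := by
        intro r hr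
        obtain ⟨hfr, hrQ⟩ := htop r hr
        have hrm : r ∈ rs := List.mem_of_mem_head? hr
        have hrF : IsFloat p emin r := inv.floats r hrm
        have hr0 : r ≠ 0 := inv.ne r hrm
        have hrs : rs = r :: rs.tail := by
          cases rs with
          | nil => simp at hr
          | cons a t =>
            simp only [List.head?_cons, Option.mem_def, Option.some.injEq] at hr
            simp [hr]
        have hsum : rs.sum = r + rs.tail.sum := by nth_rewrite 1 [hrs]; exact List.sum_cons
        refine ⟨?_, hrQ.trans ?_⟩
        · have hQnF : IsFloat p emin (g + Q) := hQnval ▸ inv'.hQ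
          rw [hQnval]
          exact fl_add_eq_self_after_absorb hp hfl hgbig inv.hQ hQg' hQnF hrF hr0 hrQ hfr
            (by rw [← hsum]; exact hstQ) (htl r _ hrs)
        · linarith [ulp_mono (p := p) (emin := emin) hQn_ge]
      exact ih Qn rs inv' hF' hbig' (by rw [hS]; exact hst') hch' hQg_next htop' htl
    · -- emitting step
      obtain ⟨inv', hbound⟩ :=
        inv.emit hp hfl le_rfl (roundoffBelow_one hp1 hfl) hg hgbig hQg' hq
      rw [compressUp_cons_of_ne_zero hq]
      generalize hQn : (fastTwoSum fl g Q).1 = Qn at *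
      generalize hqn : (fastTwoSum fl g Q).2 = q at *
      have hS : Qn + (q :: rs).sum = Q + rs.sum + g := by rw [List.sum_cons]; linarith [h4]
      have hQg_next : ∀ y ∈ rest.head?, |Qn| ≤ ulp p emin y := by
        intro y hy
        have hgy : |g| ≤ ulp p emin y := hgU y hy
        have hT : |Qn + (q :: rs).sum| < ulp p emin y := by rw [hS]; exact hst'.head_lt hy
        obtain ⟨u, hu, hU⟩ := exists_ulp_eq_two_zpow (p := p) (emin := emin) y
        obtain ⟨k, -, hK⟩ := exists_ulp_eq_two_zpow (p := p) (emin := emin) (g + Q)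
        have hkQn : OnGrid k Qn := by
          obtain ⟨K, hK'⟩ := exists_fl_eq_int_mul_ulp hp1 hfl (g + Q)
          exact ⟨K, by rw [h1, hK', hK]⟩
        have hku : k ≤ u := by
          have ht2 : |g + Q| ≤ 2 * (2 : ℚ) ^ u :=
            calc |g + Q| ≤ |g| + |Q| := abs_add_le _ _
              _ ≤ |g| + |g| := by linarith
              _ ≤ 2 * (2 : ℚ) ^ u := by rw [← hU]; linarith
          have := ulp_le_two_zpow_of_abs_le hp hu ht2
          rw [hK] at this
          exact (zpow_le_zpow_iff_right₀ (by norm_num : (1 : ℚ) < 2)).mp this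
        have hr : |(q :: rs).sum| < (2 : ℚ) ^ k := by rw [← hK, List.sum_cons]; exact hbound
        rw [hU]
        exact abs_le_two_zpow_of_onGrid hku hkQn hr (by rw [← hU]; exact hT)
      have htop' : ∀ r ∈ (q :: rs).head?, fl (Qn + r) = Qn ∧ |r| ≤ ulp p emin Qn / 2 := by
        intro r hr
        have hrq : r = q := by simpa [eq_comm] using hr
        rw [hrq]
        refine ⟨by rw [h4]; exact h1.symm, ?_⟩
        calc |q| = |g + Q - fl (g + Q)| := by rw [h2]
          _ ≤ ulp p emin (g + Q) / 2 := abs_sub_fl_le_half_ulp hp1 hfl _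
          _ ≤ ulp p emin Qn / 2 := by rw [h1]; linarith [ulp_le_ulp_fl hp1 hfl (g + Q)]
      have hq0 : q ≠ 0 := inv'.ne q (by simp)
      have htl' : ∀ r tl, q :: rs = r :: tl → |tl.sum| < |r| := by
        intro r tl h
        obtain ⟨rfl, rfl⟩ := List.cons_eq_cons.mp h
        cases hrs : rs with
        | nil => simpa using abs_pos.mpr hq0
        | cons r₀ tl₀ =>
          rw [hrs] at inv inv'
          obtain ⟨s, hsq, hr₀s⟩ : Below 1 r₀ q :=
            (List.pairwise_cons.mp inv'.pw).1 r₀ (by simp)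
          have h2s : (2 : ℚ) ^ s ≤ |q| := hsq.two_zpow_le_abs hq0
          have hr₀0 : r₀ ≠ 0 := inv.ne r₀ (by simp)
          have hall : ∀ x ∈ r₀ :: tl₀, |x| < (2 : ℚ) ^ s := by
            intro x hx
            rcases List.mem_cons.mp hx with rfl | hx
            · linarith
            · have hb : Below 1 x r₀ := (List.pairwise_cons.mp inv.pw).1 x hx
              linarith [hb.abs_lt le_rfl hr₀0]
          have hexp : IsExpansion 1 (r₀ :: tl₀).reverse := by
            unfold IsExpansion
            exact List.pairwise_reverse.mpr inv.pw
          exact (abs_sum_lt_two_zpow_of_rev inv.floats hexp hall).trans_le h2s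
      have hlist : rs.reverse ++ q :: compressUp fl Qn rest =
          (q :: rs).reverse ++ compressUp fl Qn rest := by simp
      rw [hlist]
      exact ih Qn (q :: rs) inv' hF' hbig' (by rw [hS]; exact hst') hch' hQg_next htop' htl'

/-- **THE TOP PAIR OF EVERY COMPRESS OUTPUT IS ABSORBED** (`p ≥ 2`, any round-to-nearest, gradual
underflow): for a nonoverlapping expansion `e` of floats, if `compress fl e = l ++ ⟨a, b⟩` then
`fl(b + a) = b`.  [cite: Shewchuk1997, §2.7 Thm 23 p. 331–333 (algorithm and proof structure);
BoldoEtAl2023, §2.6 Property 2.7] -/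
theorem compress_top_absorbed (hp : 2 ≤ p) {fl : ℚ → ℚ} (hfl : IsRoundNearest p emin fl)
    {e : List ℚ} (he : ∀ x ∈ e, IsFloat p emin x) (hexp : IsExpansion 1 e)
    {l : List ℚ} {a b : ℚ} (h : compress fl e = l ++ [a, b]) : fl (b + a) = b := by
  cases hrev : e.reverse with
  | nil =>
    have he0 : e = [] := by simpa using congrArg List.reverse hrev
    subst he0
    simp [compress] at h
  | cons em rest =>
    have he' : e = rest.reverse ++ [em] := by simpa using congrArg List.reverse hrev
    have hcomp : compress fl e =
        compressUp fl (compressDown fl em rest).2 (compressDown fl em rest).1.reverse := by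
      simp only [compress, hrev]
    rw [hcomp] at h
    subst he'
    have hem : IsFloat p emin em := he em (by simp)
    have hrestF : ∀ y ∈ rest, IsFloat p emin y := fun y hy => he y (by simp [hy])
    have hexp' : IsExpansion 1 rest.reverse := hexp.sublist (List.sublist_append_left _ _)
    have hbel : ∀ y ∈ rest, Below 1 y em := fun y hy =>
      (List.pairwise_append.mp hexp).2.2 y (List.mem_reverse.mpr hy) em (by simp)
    have outd := compressDown_spec hp hfl rest em hem hrestF hexp' hbel
    generalize hgs : (compressDown fl em rest).1 = gs at *
    generalize hgb : (compressDown fl em rest).2 = gb at *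
    have inv : UpInv p emin 1 [] gb :=
      ⟨by simp, outd.hgb, List.Pairwise.nil, by simp, by simp, by simpa using ulp_pos _⟩
    have hst : UStair p emin (gb + ([] : List ℚ).sum) gs.reverse := by
      have h' := uStair_reverse_of_dStair outd.stair
      rw [List.reverse_append, List.reverse_singleton, List.singleton_append, uStair_cons,
        zero_add] at h'
      simpa using h'.2
    have hch0 := List.isChain_reverse.mpr outd.chain
    rw [List.reverse_append, List.reverse_singleton, List.singleton_append,
      List.isChain_cons] at hch0
    obtain ⟨rs', Qf, hout, htop⟩ := compressUp_top_absorbed hp hfl gs.reverse gb [] inv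
      (fun g hg => outd.floats g (List.mem_reverse.mp hg))
      (fun g hg => outd.big g (List.mem_reverse.mp hg)) hst hch0.2 hch0.1 (by simp)
      (fun r tl h => by simp at h)
    rw [List.reverse_nil, List.nil_append, h] at hout
    -- `l ++ ⟨a, b⟩ = rs'.reverse ++ ⟨Qf⟩` forces `Qf = b` and `rs'.head? = a`
    have hsplit : (l ++ [a]) ++ [b] = rs'.reverse ++ [Qf] := by simpa using hout
    obtain ⟨hl, hb⟩ := List.append_inj' hsplit rfl
    have hQf : Qf = b := by simpa using hb.symm
    have hrs' : rs' = a :: l.reverse := by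
      have := congrArg List.reverse hl
      simpa using this.symm
    subst hQf
    exact htop a (by simp [hrs'])

end Summit.Ventures.CertifiedArithmetic.Expansions
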